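import Mathlib
import Summits.PneNP.PneNP.Theorems.SfmBlSpotPackage
import Summits.PneNP.PneNP.Theorems.SfmBlCylinderCounts

/-!
# Cylinder sums of the explicit spot potential `ê` and the stepwise greedy hypothesis — line «sfm-bl»
(MACHINE-PLAN M4/M5 spec)

FRONTIER F-N1c; nothing here bears on P vs NP.

The explicit spot potential of `SfmBl.spot_package_explicit` (prover-2, `SfmBlPipelineAux`) is
`ê(T) = Σ_{W ∈ bad T} meet(W)` with `bad T = {W ∈ 𝒲 : γ'·√(|W₁||W₂|) < |Σ_{W₁×W₂} M_T|}`.  For the machine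
(M4: evaluate `Σ_{T ∈ cylinder} ê(T)` exactly; M5: the greedy bit-fixing loop) this file supplies:
* `sqrt_mul_sqrt_lt_abs_iff_int`, `filter_badPairs_eq_int` — with `γ' = √G` (`G = 6000·2^60` of record,
  `sfmBl_gamma'_sq`) the real test is the INTEGER test `G·|W₁|·|W₂| < (Σ_j c_j(W)·χ(T j))²`,
  `c_j(W) = #{legs of output j from W₁ to W₂}` (`pairSum_eq_sum_outputs`);
* `sum_cylinder_hat_eq` — exchange of summation: `Σ_{T ∈ C} ê(T) = Σ_{W ∈ 𝒲} meet(W) · #{T ∈ C : integer test}`,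
  and the counts are exactly the DP counts of `SfmBlCylinderDP` (`card_cylinder_filter_eq_sum`, `dpCount_*`);
* `cylinder_congr`, `greedy_of_cylinder_steps` — the hypothesis `hgreedy` of `cutCertified_of_greedy` /
  `two_pow_smul_le_sum_of_greedy` (both sides cylinders) from the machine's STEPWISE comparisons
  "fixing bit `k` to `y k` is no worse than fixing it to `¬ y k`, given the prefix".
-/

namespace Summit.PneNP.PneNP.Theorems.SfmBl

open Matrix Finset BigOperators
open Summit.PneNP.PneNP.Theorems.CandCutNorm

/-! ### Integer form of the bad-pair test -/

/-- `√G·√(ab) < |d| ↔ G·a·b < d²` for naturals `G, a, b` and an integer `d`. -/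
theorem sqrt_mul_sqrt_lt_abs_iff_int (G a b : ℕ) (d : ℤ) :
    Real.sqrt G * Real.sqrt ((a : ℝ) * b) < |(d : ℝ)| ↔ (G * a * b : ℤ) < d ^ 2 := by
  rw [mul_sqrt_lt_abs_iff (Real.sqrt_nonneg _) (Nat.cast_nonneg a) (Nat.cast_nonneg b),
    Real.sq_sqrt (Nat.cast_nonneg G)]
  have e1 : ((G : ℝ) * ((a : ℝ) * b) : ℝ) = ((G * a * b : ℤ) : ℝ) := by push_cast; ring
  have e2 : ((d : ℝ)) ^ 2 = ((d ^ 2 : ℤ) : ℝ) := by push_cast; ring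
  rw [e1, e2, Int.cast_lt]

/-- THE BAD-PAIR FAMILY IN INTEGER FORM: for the signed matrix of the legs and `γ' = √G`,
`{W ∈ 𝒲 : γ'√(|W₁||W₂|) < |Σ_{i∈W₁,k∈W₂} M i k|} = {W ∈ 𝒲 : G|W₁||W₂| < (Σ_j c_j(W) χ(T j))²}`. -/
theorem filter_badPairs_eq_int {α β E : Type} [Fintype α] [Fintype β] [Fintype E] [DecidableEq α]
    [DecidableEq β] {m : ℕ} (src : E → α) (dst : E → β) (out : E → Fin m) (G : ℕ)
    (T : Fin m → Bool) (M : Matrix α β ℝ)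
    (hM : ∀ i k, M i k = ∑ e ∈ Finset.univ.filter (fun e => src e = i ∧ dst e = k),
      ((boolSign (T (out e)) : ℤ) : ℝ))
    (𝒲 : Finset (Finset α × Finset β)) :
    (𝒲.filter fun W =>
        Real.sqrt G * Real.sqrt ((W.1.card : ℝ) * (W.2.card : ℝ)) < |∑ i ∈ W.1, ∑ k ∈ W.2, M i k|)
      = 𝒲.filter fun W => (G * W.1.card * W.2.card : ℤ)
          < (∑ j, ((Finset.univ.filter fun e => out e = j ∧ src e ∈ W.1 ∧ dst e ∈ W.2).card : ℤ)
              * boolSign (T j)) ^ 2 := by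
  refine Finset.filter_congr fun W _ => ?_
  rw [pairSum_eq_sum_outputs src dst out T M hM W.1 W.2]
  have e : ∑ j, ((Finset.univ.filter fun e => out e = j ∧ src e ∈ W.1 ∧ dst e ∈ W.2).card : ℝ)
        * ((boolSign (T j) : ℤ) : ℝ)
      = ((∑ j, ((Finset.univ.filter fun e => out e = j ∧ src e ∈ W.1 ∧ dst e ∈ W.2).card : ℤ)
          * boolSign (T j) : ℤ) : ℝ) := by
    push_cast; rfl
  rw [e, sqrt_mul_sqrt_lt_abs_iff_int]

/-- THE `ê`-POTENTIAL OVER A SET OF SIGNINGS IS A WEIGHTED SUM OF PER-PAIR COUNTS (what M4 computes):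
`Σ_{T∈C} Σ_{W ∈ 𝒲 bad for T} w(W) = Σ_{W∈𝒲} w(W) · #{T ∈ C : G|W₁||W₂| < (Σ_j c_j(W) χ(T j))²}`. -/
theorem sum_cylinder_hat_eq {α β E : Type} [Fintype α] [Fintype β] [Fintype E] [DecidableEq α]
    [DecidableEq β] {m : ℕ} (src : E → α) (dst : E → β) (out : E → Fin m) (G : ℕ)
    (M : (Fin m → Bool) → Matrix α β ℝ)
    (hM : ∀ T i k, M T i k = ∑ e ∈ Finset.univ.filter (fun e => src e = i ∧ dst e = k),
      ((boolSign (T (out e)) : ℤ) : ℝ))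
    (𝒲 : Finset (Finset α × Finset β)) (w : Finset α × Finset β → ℝ) (C : Finset (Fin m → Bool)) :
    ∑ T ∈ C, ∑ W ∈ 𝒲.filter (fun W =>
        Real.sqrt G * Real.sqrt ((W.1.card : ℝ) * (W.2.card : ℝ)) < |∑ i ∈ W.1, ∑ k ∈ W.2, M T i k|),
        w W
      = ∑ W ∈ 𝒲, w W * ((C.filter fun T : Fin m → Bool => (G * W.1.card * W.2.card : ℤ)
          < (∑ j, ((Finset.univ.filter fun e => out e = j ∧ src e ∈ W.1 ∧ dst e ∈ W.2).card : ℤ)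
              * boolSign (T j)) ^ 2).card : ℝ) := by
  have h : ∀ T ∈ C, ∑ W ∈ 𝒲.filter (fun W =>
        Real.sqrt G * Real.sqrt ((W.1.card : ℝ) * (W.2.card : ℝ)) < |∑ i ∈ W.1, ∑ k ∈ W.2, M T i k|),
        w W
      = ∑ W ∈ 𝒲.filter (fun W => (G * W.1.card * W.2.card : ℤ)
          < (∑ j, ((Finset.univ.filter fun e => out e = j ∧ src e ∈ W.1 ∧ dst e ∈ W.2).card : ℤ)
              * boolSign (T j)) ^ 2), w W := fun T _ => by
    rw [filter_badPairs_eq_int src dst out G T (M T) (hM T) 𝒲]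
  rw [Finset.sum_congr rfl h]
  exact sum_sum_filter_eq_sum_mul_card C 𝒲 w _

/-! ### The greedy hypothesis from stepwise comparisons -/

/-- A cylinder only depends on the base point through its values on the fixed set. -/
theorem cylinder_congr {m : ℕ} (P : Finset (Fin m)) {T₀ T₁ : Fin m → Bool} (h : ∀ i ∈ P, T₀ i = T₁ i) :
    (Finset.univ.filter fun T : Fin m → Bool => ∀ i ∈ P, T i = T₀ i)
      = Finset.univ.filter fun T : Fin m → Bool => ∀ i ∈ P, T i = T₁ i := by
  refine Finset.filter_congr fun T _ => forall₂_congr fun i hi => ?_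
  rw [h i hi]

/-- `hgreedy` OF `SfmBl.cutCertified_of_greedy` FROM THE MACHINE'S STEPWISE CHOICES: if at every step `k` the
chosen bit `y k` makes the `F`-sum over the cylinder `{T : T = y on {i < k+1}}` at most the sum over the sibling
cylinder (bit `k` flipped), then the prefix-class form of the greedy hypothesis holds. -/
theorem greedy_of_cylinder_steps {m : ℕ} (F : (Fin m → Bool) → ℝ) (y : Fin m → Bool)
    (hy : ∀ (k : ℕ) (hk : k < m),
      ∑ T ∈ Finset.univ.filter (fun T : Fin m → Bool =>
          ∀ i ∈ Finset.univ.filter (fun i : Fin m => (i : ℕ) < k + 1), T i = y i), F T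
        ≤ ∑ T ∈ Finset.univ.filter (fun T : Fin m → Bool =>
          ∀ i ∈ Finset.univ.filter (fun i : Fin m => (i : ℕ) < k + 1),
            T i = Function.update y ⟨k, hk⟩ (!y ⟨k, hk⟩) i), F T)
    (k : ℕ) (hk : k < m) :
    ∑ T ∈ Finset.univ.filter (fun T : Fin m → Bool => ∀ i : Fin m, (i : ℕ) < k + 1 → T i = y i), F T
      ≤ ∑ T ∈ Finset.univ.filter (fun T : Fin m → Bool =>
          (∀ i : Fin m, (i : ℕ) < k → T i = y i) ∧ T ⟨k, hk⟩ ≠ y ⟨k, hk⟩), F T := by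
  rw [filter_prefix_eq_cylinder y (k + 1), filter_prefix_flip_eq_cylinder y k hk]
  exact hy k hk

/-! ### The explicit spot package -/

end Summit.PneNP.PneNP.Theorems.SfmBl
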